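import Mathlib
import HarnessLib
import Summits.HubbardSuperconductivity.HubbardSuperconductivity.Theorems.KLProgrammeKLRegimeEngineV8TwoLegGridMomentsFrameBaseKlE3A1

/-!
# Route `KLProgramme` — ENGINE child gen 8 (stmt-HubbardSuperconductivity-20437 `KLRegimeEngineV17F2`), located risk #9 RESOLVED-ELECT (T′-B)
# «PARAMETRISED MIXED CURRENCY» (pen (R60g)/(R60i)): the LITERAL MODULE, part 1 — the `R`-keyed closed terms of the scale-0 frame-`K` base
# (`klFrameKR`, `klFrameMR`, `klFrameA`, `klZt0`, `klZs20`, `klZs1Base`, `klGridU₀`) and the two base rows + the producer `U`-row RESTATED IN THESE NAMES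

Cell gate-hubbard-kl, seat hubbard-kl-k3c2-p1 g8 (filer of record of the literal module, (R60g)(4)/(R60i)).  Part 1 = what THIS lineage fixes: the
n = 0 base constants, all `R`-keyed because p3's frame-`K` decay constant fits under `klE3A1 R` at regime depth (`frameAlpha_le_klE3A1`, p575046).
Part 2 (the class-#7 owner's / W3's number) = `klZs1 P R := klZs1Base R + <slice increments' M₁(K)-linear share>`, `klZs1_nonneg`, and the fit of
`klZs20 R + <increments' U²-share>` under the rev-4′ literal `2¹¹·e¹⁸·κ₀⁴·klE3Acum R` — a separate file importing this one (NOT `…DefsU11`: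
cycle `DefsU11 → klTowerGrid → klZs1`).

* §1 the literals: `klFrameKR R = κ_R := 256((4/3)√(24π²(Gfr₀+1)(Gfr₂+1)) + (128/15)(Gfr₀+1))` (the frame kernel's `ℓ¹/|U|`, this lineage's
  `sum_norm_framePosKernel_le_linear_of_frameOK`), `klFrameMR R = m_R := 6(πGfr₁/2 + π²Gfr₂/(2√2) + π³Gfr₃/8)` (p3's first-moment constant),
  `klFrameA R = A := 4e⁴κ_R + 16e⁸κ₀²` (`κ₀² = 2(7+1606732)`), **`klZt0 R := 4e²A²·klE3A1 R`** (time row), **`klZs20 R := 8e²A²·klE3A1 R`** (space row,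
  `U²` share), **`klZs1Base R := 256e⁶·A·m_R·klE3A1 R`** (space row, `(Nsc+1)U²·|U|` share of the BASE), **`klGridU₀ R := 1/(4e·A·klE3A1 R)`** (the
  producer `U`-row of both rows); signs (`_nonneg`/`_pos` under `R.WF`);
* §2 **`twoLegGrid_time_row_scaleZero_klZt0`**, **`twoLegGrid_space_row_scaleZero_klZs`** — binders `FrameOK R U Nsc μ K`, `R.WF`, `0 < U ≤ klGridU₀ R`,
  `|U| ≤ 1`, `(Nsc+1)U² ≤ 1`, `klBetaMin ≤ β`, `klEngL₃/M₃` ⇒ time row `≤ klZt0 R·U²·β/(2N)`, space row `≤ (klZs20 R·U² + klZs1Base R·((Nsc+1)U²)·|U|)·β/(2N)`.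

Definitions with bodies + order lemmas + two by-name rows; nothing about the model's sizes beyond p575046 is asserted; nothing asserts superconductivity.
`--supports stmt-HubbardSuperconductivity-20437`.  References: BGM 2006 §3 (3.2)–(3.8) [cite: BenfattoGiulianiMastropietro2006].
-/

noncomputable section

namespace Summit.HubbardSuperconductivity.HubbardSuperconductivity.Theorems.EngineV8

set_option linter.dupNamespace false -- summit = problem name (single-conjunct summit), D-0017

open Real Finset Literature.MathematicalPhysics.QuantumLattice Literature.Probability.LatticeModels
open Literature.Probability.LatticeModels.BattleFederbush GrassmannAlgebra
open Summit.HubbardSuperconductivity.HubbardSuperconductivity.Theorems.KLRegimeSplit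
open Summit.HubbardSuperconductivity.HubbardSuperconductivity.Theorems.KLProgrammeLegKernels

/-! ## §1 The `R`-keyed literals of the scale-0 frame-`K` base -/

/-- **`klFrameKR R = κ_R`** — the `ℓ¹/|U|` constant of an admissible frame's position kernel (`Σ_z ‖Ǩ_L z‖ ≤ κ_R|U|`). -/
def klFrameKR (R : RenConsts) : ℝ :=
  256 * ((4 / 3) * Real.sqrt (24 * π ^ 2 * (R.Gfr 0 + 1) * (R.Gfr 2 + 1)) + (128 / 15) * (R.Gfr 0 + 1))

/-- **`klFrameMR R = m_R`** — p3's first-moment constant of a frame piece (`Σ_z |z̃_j|‖Ǩ_L z‖ ≤ (Nsc+1)U²·m_R`). -/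
def klFrameMR (R : RenConsts) : ℝ :=
  6 * (Real.pi * R.Gfr 1 / 2 + Real.pi ^ 2 * R.Gfr 2 / (2 * Real.sqrt 2) + Real.pi ^ 3 * R.Gfr 3 / 8)

/-- **`klFrameA R = A := 4e⁴κ_R + 16e⁸κ₀²`** — the `|U|`-coefficient of the grid vertex's plain profile in the W-chain smallness (`κ₀² = 2(7+1606732)`). -/
def klFrameA (R : RenConsts) : ℝ := 4 * Real.exp 1 ^ 4 * klFrameKR R + 16 * Real.exp 1 ^ 8 * Real.sqrt (2 * (7 + 1606732)) ^ 2

/-- **`klZt0 R := 4e²·A²·klE3A1 R`** — the TIME-row literal of the scale-0 frame-`K` base (pure `U²` currency). -/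
def klZt0 (R : RenConsts) : ℝ := 4 * Real.exp 1 ^ 2 * klFrameA R ^ 2 * klE3A1 R

/-- **`klZs20 R := 8e²·A²·klE3A1 R`** — the `U²` share of the SPACE-row literal of the scale-0 frame-`K` base. -/
def klZs20 (R : RenConsts) : ℝ := 8 * Real.exp 1 ^ 2 * klFrameA R ^ 2 * klE3A1 R

/-- **`klZs1Base R := 256e⁶·A·m_R·klE3A1 R`** — the `(Nsc+1)U²·|U|` (= `ĉ·|U|`) share of the SPACE row of the BASE (the Leibniz term `ℓ¹(K)·M₁(K)`);
the (T′-B) literal `klZs1 P R` is this plus the slice increments' share (part 2). -/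
def klZs1Base (R : RenConsts) : ℝ := 256 * Real.exp 1 ^ 6 * klFrameA R * klFrameMR R * klE3A1 R

/-- **`klGridU₀ R := 1/(4e·A·klE3A1 R)`** — the producer `U`-row of both base rows (`2e·klE3A1·A·|U| ≤ 1/2`). -/
def klGridU₀ (R : RenConsts) : ℝ := 1 / (4 * Real.exp 1 * klFrameA R * klE3A1 R)

/-- `0 ≤ κ_R` under `R.WF`. -/
theorem klFrameKR_nonneg {R : RenConsts} (hR : R.WF) : 0 ≤ klFrameKR R := by
  have := hR.2.2 0; unfold klFrameKR; positivity

/-- `0 ≤ m_R` under `R.WF`. -/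
theorem klFrameMR_nonneg {R : RenConsts} (hR : R.WF) : 0 ≤ klFrameMR R := by
  have := hR.2.2 1; have := hR.2.2 2; have := hR.2.2 3; unfold klFrameMR; positivity

/-- `0 < A` under `R.WF`. -/
theorem klFrameA_pos {R : RenConsts} (hR : R.WF) : 0 < klFrameA R := by
  have := klFrameKR_nonneg hR; unfold klFrameA; positivity

/-- `0 < klZt0 R` under `R.WF`. -/
theorem klZt0_pos {R : RenConsts} (hR : R.WF) : 0 < klZt0 R := by
  have := klFrameA_pos hR; have := klE3A1_pos R; unfold klZt0; positivity

/-- `0 < klZs20 R` under `R.WF`. -/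
theorem klZs20_pos {R : RenConsts} (hR : R.WF) : 0 < klZs20 R := by
  have := klFrameA_pos hR; have := klE3A1_pos R; unfold klZs20; positivity

/-- `0 ≤ klZs1Base R` under `R.WF`. -/
theorem klZs1Base_nonneg {R : RenConsts} (hR : R.WF) : 0 ≤ klZs1Base R := by
  have := klFrameA_pos hR; have := klFrameMR_nonneg hR; have := klE3A1_pos R; unfold klZs1Base; positivity

/-- `0 < klGridU₀ R` under `R.WF`. -/
theorem klGridU₀_pos {R : RenConsts} (hR : R.WF) : 0 < klGridU₀ R := by
  have := klFrameA_pos hR; have := klE3A1_pos R; unfold klGridU₀; positivity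

/-- `klZs20 = 2·klZt0` (the space row's `U²` share is twice the time row's). -/
theorem klZs20_eq_two_mul_klZt0 (R : RenConsts) : klZs20 R = 2 * klZt0 R := by unfold klZs20 klZt0; ring

/-- **The `U`-row gives both producer smallnesses**: `0 < U ≤ klGridU₀ R` ⇒ `2e·klE3A1 R·A·|U| ≤ 1/2`. -/
theorem two_mul_exp_mul_klE3A1_mul_klFrameA_mul_abs_le {R : RenConsts} (hR : R.WF) {U : ℝ} (hU : 0 < U) (hU₀ : U ≤ klGridU₀ R) :
    2 * Real.exp 1 * klE3A1 R * klFrameA R * |U| ≤ 1 / 2 := by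
  have hA := klFrameA_pos hR
  have hE := klE3A1_pos R
  have he := Real.exp_pos 1
  have hden : 0 < 4 * Real.exp 1 * klFrameA R * klE3A1 R := by positivity
  rw [abs_of_pos hU]
  have h1 : U * (4 * Real.exp 1 * klFrameA R * klE3A1 R) ≤ 1 := by
    have := mul_le_mul_of_nonneg_right hU₀ hden.le
    rwa [klGridU₀, one_div, inv_mul_cancel₀ hden.ne'] at this
  nlinarith

/-! ## §2 The two base rows in the literals' names -/

section Rows

variable {L M : ℕ} [NeZero L] [NeZero M] {R : RenConsts} {μ U β : ℝ} {Nsc : ℕ} {K : TrigPolyC4v}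

/-- **TIME row `≤ klZt0 R·U²·β/(2N)`** (`FrameOK R U Nsc μ K`, `R.WF`, `0 < U ≤ klGridU₀ R`, `|U| ≤ 1`, `(Nsc+1)U² ≤ 1`, `klBetaMin ≤ β`, thresholds). -/
theorem twoLegGrid_time_row_scaleZero_klZt0 (hK : FrameOK R U Nsc μ K) (hR : R.WF) (hU : 0 < U) (hU₀ : U ≤ klGridU₀ R) (hU1 : |U| ≤ 1)
    (hN : ((Nsc : ℝ) + 1) * U ^ 2 ≤ 1) (hβ : klBetaMin ≤ β) (hL : klEngL₃ β U ≤ L) (hM : klEngM₃ β U L ≤ M)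
    (σ : Fin 2) (p₀ : GridPoint L (2 * (2 * M))) :
    ∑ p₁ : GridPoint L (2 * (2 * M)),
      β / ((2 * (2 * M) : ℕ) : ℝ) * (circDist (2 * (2 * M)) p₀.1.val p₁.1.val : ℝ) *
        ‖kernel ℂ
          (effAction ℂ ((hubbardGridSub L M β (2 * (2 * M))).transpose *
              hubbardCovAboveCT L M β μ 0 K (klScale klE0 0) * hubbardGridSub L M β (2 * (2 * M)))
            (hubbardGridInteraction L (2 * (2 * M)) β U + hubbardGridCounterQuadratic L (2 * (2 * M)) β K) -
            hubbardGridCounterQuadratic L (2 * (2 * M)) β K) 2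
          (fun i => ((![p₀, p₁] i, σ), i))‖ ≤
      klZt0 R * U ^ 2 * (β / (2 * ((2 * (2 * M) : ℕ) : ℝ))) := by
  have hs := two_mul_exp_mul_klE3A1_mul_klFrameA_mul_abs_le hR hU hU₀
  have hsmall : Real.exp 1 * klE3A1 R * |U| *
      (4 * Real.exp 1 ^ 4 * (256 * ((4 / 3) * Real.sqrt (24 * π ^ 2 * (R.Gfr 0 + 1) * (R.Gfr 2 + 1)) + (128 / 15) * (R.Gfr 0 + 1))) +
        16 * Real.exp 1 ^ 8 * Real.sqrt (2 * (7 + 1606732)) ^ 2) ≤ 1 / 2 := by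
    have h0 : 0 ≤ Real.exp 1 * klE3A1 R * klFrameA R * |U| :=
      mul_nonneg (mul_nonneg (mul_nonneg (Real.exp_pos 1).le (klE3A1_pos R).le) (klFrameA_pos hR).le) (abs_nonneg U)
    have h1 : Real.exp 1 * klE3A1 R * |U| *
        (4 * Real.exp 1 ^ 4 * (256 * ((4 / 3) * Real.sqrt (24 * π ^ 2 * (R.Gfr 0 + 1) * (R.Gfr 2 + 1)) + (128 / 15) * (R.Gfr 0 + 1))) +
          16 * Real.exp 1 ^ 8 * Real.sqrt (2 * (7 + 1606732)) ^ 2) = Real.exp 1 * klE3A1 R * klFrameA R * |U| := by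
      unfold klFrameA klFrameKR; ring
    rw [h1]; linarith
  refine (twoLegGrid_time_row_scaleZero_of_frameOK_klE3A1 hK hR hU hU1 hN hβ hL hM hsmall σ p₀).trans (le_of_eq ?_)
  unfold klZt0 klFrameA klFrameKR
  ring

/-- **SPACE row `≤ (klZs20 R·U² + klZs1Base R·((Nsc+1)U²)·|U|)·β/(2N)`** (same binders; the (T′-B) mixed currency of the BASE). -/
theorem twoLegGrid_space_row_scaleZero_klZs (hK : FrameOK R U Nsc μ K) (hR : R.WF) (hU : 0 < U) (hU₀ : U ≤ klGridU₀ R) (hU1 : |U| ≤ 1)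
    (hN : ((Nsc : ℝ) + 1) * U ^ 2 ≤ 1) (hβ : klBetaMin ≤ β) (hL : klEngL₃ β U ≤ L) (hM : klEngM₃ β U L ≤ M)
    (σ : Fin 2) (p₀ : GridPoint L (2 * (2 * M))) :
    ∑ p₁ : GridPoint L (2 * (2 * M)),
      (if p₁.2 - p₀.2 = 0 then (0 : ℝ) else
        (1 + (((p₁.2 - p₀.2) 0).valMinAbs.natAbs : ℝ) + (((p₁.2 - p₀.2) 1).valMinAbs.natAbs : ℝ))) *
        ‖kernel ℂ
          (effAction ℂ ((hubbardGridSub L M β (2 * (2 * M))).transpose *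
              hubbardCovAboveCT L M β μ 0 K (klScale klE0 0) * hubbardGridSub L M β (2 * (2 * M)))
            (hubbardGridInteraction L (2 * (2 * M)) β U + hubbardGridCounterQuadratic L (2 * (2 * M)) β K) -
            hubbardGridCounterQuadratic L (2 * (2 * M)) β K) 2
          (fun i => ((![p₀, p₁] i, σ), i))‖ ≤
      (klZs20 R * U ^ 2 + klZs1Base R * (((Nsc : ℝ) + 1) * U ^ 2) * |U|) * (β / (2 * ((2 * (2 * M) : ℕ) : ℝ))) := by
  have hs := two_mul_exp_mul_klE3A1_mul_klFrameA_mul_abs_le hR hU hU₀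
  have hsmall : 2 * Real.exp 1 * klE3A1 R *
      (4 * Real.exp 1 ^ 4 * (256 * ((4 / 3) * Real.sqrt (24 * π ^ 2 * (R.Gfr 0 + 1) * (R.Gfr 2 + 1)) + (128 / 15) * (R.Gfr 0 + 1))) +
        16 * Real.exp 1 ^ 8 * Real.sqrt (2 * (7 + 1606732)) ^ 2) * |U| ≤ 1 / 2 := by
    have h1 : 2 * Real.exp 1 * klE3A1 R *
        (4 * Real.exp 1 ^ 4 * (256 * ((4 / 3) * Real.sqrt (24 * π ^ 2 * (R.Gfr 0 + 1) * (R.Gfr 2 + 1)) + (128 / 15) * (R.Gfr 0 + 1))) +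
          16 * Real.exp 1 ^ 8 * Real.sqrt (2 * (7 + 1606732)) ^ 2) * |U| = 2 * Real.exp 1 * klE3A1 R * klFrameA R * |U| := by
      unfold klFrameA klFrameKR; ring
    rw [h1]; exact hs
  refine (twoLegGrid_space_row_scaleZero_of_frameOK_mixed_klE3A1 hK hR hU hU1 hN hβ hL hM hsmall σ p₀).trans (le_of_eq ?_)
  unfold klZs20 klZs1Base klFrameA klFrameKR klFrameMR
  ring

end Rows

end Summit.HubbardSuperconductivity.HubbardSuperconductivity.Theorems.EngineV8

end
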